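import Summits.Ventures.HodgeRepro2.LevelFiniteIndex
import Summits.Ventures.HodgeRepro2.HeckeSlashOperator

/-!
# Commensurability: `[S : S_δ] < ∞` for `δ ∈ U(H)(K)` and congruence subgroups `S ⊆ Γ₁`

Kernel support for the blind cell pub-hodge-repro2 (seat p2), Tier 5 (Hecke side): the finiteness
hypothesis `[Fintype (S ⧸ S_δ)]` of `HeckeSlashOperator.lean` / `HeckeSlashSelfAdjoint.lean` is PROVED
for every subgroup `S` of finite index in `Γ₁ = Γ_1(H, 𝔪)` and every `δ ∈ U(H)(K)`:

* clearing denominators in the lattice `𝔪`: `N • (x δ) ∈ 𝔪` for all `x ∈ 𝔪` with one `N ≠ 0`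
  (`𝔪` is finitely generated and spans `K^m` over `ℚ`);
* `δ Γ_M δ⁻¹ ⊆ Γ₁` for `M = N₁ N₂` (`x δ γ δ⁻¹ = x − N₂ • (y δ⁻¹)` with `u − u γ = M • y`);
* hence `S ∩ Γ_M ≤ S_δ`, and `S ∩ Γ_M` has finite index in `S` (row 54: `[Γ₁ : Γ_M] < ∞`).
-/

namespace Summit.Ventures.HodgeRepro2.ShimuraData

open scoped Pointwise

section Denominators

variable {K : Type*} [Field K] [NumberField K] {m : ℕ}

/-- Clearing denominators in the `ℚ`-span of a `ℤ`-submodule. -/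
theorem exists_nsmul_mem_of_mem_span_rat (𝔪 : Submodule ℤ (Fin m → K)) {x : Fin m → K}
    (hx : x ∈ Submodule.span ℚ (𝔪 : Set (Fin m → K))) : ∃ n : ℕ, n ≠ 0 ∧ n • x ∈ 𝔪 := by
  induction hx using Submodule.span_induction with
  | mem y hy => exact ⟨1, one_ne_zero, by simpa using hy⟩
  | zero => exact ⟨1, one_ne_zero, by simp⟩
  | add y z _ _ ihy ihz =>
    obtain ⟨n, hn, hny⟩ := ihy
    obtain ⟨k, hk, hkz⟩ := ihz
    refine ⟨n * k, mul_ne_zero hn hk, ?_⟩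
    rw [smul_add]
    refine 𝔪.add_mem ?_ ?_
    · rw [mul_comm, mul_smul]
      exact 𝔪.smul_of_tower_mem _ hny
    · rw [mul_smul]
      exact 𝔪.smul_of_tower_mem _ hkz
  | smul q y _ ih =>
    obtain ⟨n, hn, hny⟩ := ih
    refine ⟨q.den * n, mul_ne_zero q.den_nz hn, ?_⟩
    have h1 : (q.den * n) • (q • y) = q.num • (n • y) := by
      rw [← Nat.cast_smul_eq_nsmul ℚ, ← Nat.cast_smul_eq_nsmul ℚ n y, ← Int.cast_smul_eq_zsmul ℚ,
        smul_smul, smul_smul]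
      congr 1
      push_cast
      rw [mul_comm (q.den : ℚ) n, mul_assoc, Rat.den_mul_eq_num]
      ring
    rw [h1]
    exact 𝔪.smul_mem _ hny

/-- **Uniform denominators for `x ↦ x δ`** on a lattice: `N • (x δ) ∈ 𝔪` for all `x ∈ 𝔪`. -/
theorem IsLattice.exists_nsmul_vecMul_mem {𝔪 : Submodule ℤ (Fin m → K)} (h : IsLattice K 𝔪)
    (δ : Matrix (Fin m) (Fin m) K) :
    ∃ N : ℕ, N ≠ 0 ∧ ∀ x ∈ 𝔪, N • Matrix.vecMul x δ ∈ 𝔪 := by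
  haveI : Module.Finite ℤ 𝔪 := h.1
  obtain ⟨n, g, hg⟩ := Submodule.fg_iff_exists_fin_generating_family.mp (Module.Finite.iff_fg.mp h.1)
  have hmem : ∀ i, Matrix.vecMul (g i) δ ∈ Submodule.span ℚ (𝔪 : Set (Fin m → K)) := by
    intro i
    rw [h.2]
    exact Submodule.mem_top
  choose N hN hNmem using fun i => exists_nsmul_mem_of_mem_span_rat 𝔪 (hmem i)
  refine ⟨∏ i, N i, Finset.prod_ne_zero_iff.mpr fun i _ => hN i, fun x hx => ?_⟩
  rw [← hg] at hx
  induction hx using Submodule.span_induction with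
  | mem y hy =>
    obtain ⟨i, rfl⟩ := hy
    rw [← Finset.mul_prod_erase Finset.univ N (Finset.mem_univ i), mul_comm, mul_smul]
    exact 𝔪.smul_of_tower_mem _ (hNmem i)
  | zero => simp
  | add y z _ _ ihy ihz =>
    rw [Matrix.add_vecMul, smul_add]
    exact 𝔪.add_mem ihy ihz
  | smul a y _ ih =>
    rw [Matrix.smul_vecMul, smul_comm]
    exact 𝔪.smul_mem a ih

end Denominators

section Conjugation

variable {K : Type*} [Field K] [NumberField K] [NumberField.IsCMField K] {H : Matrix (Fin 3) (Fin 3) K}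
    {𝔪 : Submodule ℤ (Fin 3 → K)}

/-- The computation behind the conjugation: if `N₁ • (𝔪 δ) ⊆ 𝔪`, `N₂ • (𝔪 δ⁻¹) ⊆ 𝔪` and `γ ∈ Γ_{N₁ N₂ N}`,
then for `x ∈ 𝔪`: `x δ γ δ⁻¹ = x − N • w` with `w = N₂ • (y δ⁻¹) ∈ 𝔪`, where `u − u γ = (N₁ N₂ N) • y` for
`u = N₁ • (x δ)`. -/
theorem exists_vecMul_conj_eq {δ : GL (Fin 3) K} {N₁ N₂ N : ℕ} (hN₁ : N₁ ≠ 0)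
    (h1 : ∀ x ∈ 𝔪, N₁ • Matrix.vecMul x (δ : Matrix (Fin 3) (Fin 3) K) ∈ 𝔪)
    (h2 : ∀ x ∈ 𝔪, N₂ • Matrix.vecMul x ((δ⁻¹ : GL (Fin 3) K) : Matrix (Fin 3) (Fin 3) K) ∈ 𝔪)
    {γ : GL (Fin 3) K} (hγ : γ ∈ shimuraLevel K H 𝔪 (N₁ * N₂ * N)) {x : Fin 3 → K} (hx : x ∈ 𝔪) :
    ∃ w ∈ 𝔪, Matrix.vecMul x ((δ * γ * δ⁻¹ : GL (Fin 3) K) : Matrix (Fin 3) (Fin 3) K) = x - (N : ℤ) • w := by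
  obtain ⟨-, -, -, hγ3⟩ := hγ
  set u : Fin 3 → K := N₁ • Matrix.vecMul x (δ : Matrix (Fin 3) (Fin 3) K) with hu
  obtain ⟨y, hy, hyu⟩ := hγ3 u (h1 x hx)
  refine ⟨N₂ • Matrix.vecMul y ((δ⁻¹ : GL (Fin 3) K) : Matrix (Fin 3) (Fin 3) K), h2 y hy, ?_⟩
  have key : N₁ • Matrix.vecMul x ((δ * γ * δ⁻¹ : GL (Fin 3) K) : Matrix (Fin 3) (Fin 3) K) =
      N₁ • (x - (N : ℤ) • (N₂ • Matrix.vecMul y ((δ⁻¹ : GL (Fin 3) K) : Matrix (Fin 3) (Fin 3) K))) := by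
    have huγ : Matrix.vecMul u (γ : Matrix (Fin 3) (Fin 3) K) = u - ((N₁ * N₂ * N : ℕ) : ℤ) • y := by
      rw [← hyu]; abel
    have hz : (((N₁ * N₂ * N : ℕ) : ℤ) • y) = N₁ • ((N : ℤ) • (N₂ • y)) := by
      rw [natCast_zsmul, mul_smul, mul_smul, natCast_zsmul, smul_comm (N₂) N y]
    rw [Units.val_mul, Units.val_mul, ← Matrix.vecMul_vecMul, ← Matrix.vecMul_vecMul, smul_sub,
      ← Matrix.smul_vecMul, ← Matrix.smul_vecMul, ← hu, huγ, Matrix.sub_vecMul, hu, Matrix.smul_vecMul,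
      Matrix.vecMul_vecMul, ← Units.val_mul, mul_inv_cancel, Units.val_one, Matrix.vecMul_one, hz,
      Matrix.smul_vecMul, Matrix.smul_vecMul, Matrix.smul_vecMul]
  exact smul_right_injective (Fin 3 → K) hN₁ key

/-- **`δ Γ_M δ⁻¹ ⊆ Γ_N`** for `δ ∈ U(H)(K)`, every `N ≠ 0`, and a suitable `M ≠ 0`. -/
theorem exists_conj_shimuraLevel_subset (h𝔪 : IsLattice K 𝔪) {δ : GL (Fin 3) K}
    (hδ : δ ∈ unitaryGroup K H) (N : ℕ) (hN : N ≠ 0) :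
    ∃ M : ℕ, M ≠ 0 ∧ ∀ γ ∈ shimuraLevel K H 𝔪 M, δ * γ * δ⁻¹ ∈ shimuraLevel K H 𝔪 N := by
  obtain ⟨N₁, hN₁, h1⟩ := h𝔪.exists_nsmul_vecMul_mem (δ : Matrix (Fin 3) (Fin 3) K)
  obtain ⟨N₂, hN₂, h2⟩ := h𝔪.exists_nsmul_vecMul_mem ((δ⁻¹ : GL (Fin 3) K) : Matrix (Fin 3) (Fin 3) K)
  refine ⟨N₁ * N₂ * N, mul_ne_zero (mul_ne_zero hN₁ hN₂) hN, fun γ hγ => ?_⟩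
  have hγinv : γ⁻¹ ∈ shimuraLevel K H 𝔪 (N₁ * N₂ * N) := by
    rw [← coe_shimuraLevelSubgroup] at hγ ⊢
    exact (shimuraLevelSubgroup K H 𝔪 (N₁ * N₂ * N)).inv_mem hγ
  have hstab : ∀ x ∈ 𝔪, Matrix.vecMul x ((δ * γ * δ⁻¹ : GL (Fin 3) K) : Matrix (Fin 3) (Fin 3) K) ∈ 𝔪 := by
    intro x hx
    obtain ⟨w, hw, hxw⟩ := exists_vecMul_conj_eq hN₁ h1 h2 hγ hx
    rw [hxw]
    exact 𝔪.sub_mem hx (𝔪.smul_mem _ hw)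
  have hstab' : ∀ x ∈ 𝔪, Matrix.vecMul x (((δ * γ * δ⁻¹)⁻¹ : GL (Fin 3) K) : Matrix (Fin 3) (Fin 3) K) ∈ 𝔪 := by
    intro x hx
    have : (δ * γ * δ⁻¹)⁻¹ = δ * γ⁻¹ * δ⁻¹ := by group
    rw [this]
    obtain ⟨w, hw, hxw⟩ := exists_vecMul_conj_eq hN₁ h1 h2 hγinv hx
    rw [hxw]
    exact 𝔪.sub_mem hx (𝔪.smul_mem _ hw)
  have hγSU : γ ∈ specialUnitaryGroup K H := hγ.1
  refine ⟨?_, hstab, hstab', fun x hx => ?_⟩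
  · obtain ⟨hγU, hγdet⟩ := Subgroup.mem_inf.mp hγSU
    have hdet : Matrix.GeneralLinearGroup.det γ = 1 := MonoidHom.mem_ker.mp hγdet
    refine Subgroup.mem_inf.mpr ⟨(unitaryGroup K H).mul_mem ((unitaryGroup K H).mul_mem hδ hγU)
      ((unitaryGroup K H).inv_mem hδ), MonoidHom.mem_ker.mpr ?_⟩
    rw [map_mul, map_mul, map_inv, hdet, mul_one, mul_inv_cancel]
  · obtain ⟨w, hw, hxw⟩ := exists_vecMul_conj_eq hN₁ h1 h2 hγ hx
    exact ⟨w, hw, by rw [hxw]; abel⟩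

end Conjugation

section FiniteIndex

variable {K : Type*} [Field K] [NumberField K] [NumberField.IsCMField K] {H : Matrix (Fin 3) (Fin 3) K}
    {𝔪 : Submodule ℤ (Fin 3 → K)}

/-- **Commensurability**: for a congruence subgroup `Γ_{N'} ≤ S ≤ Γ₁` and `δ ∈ U(H)(K)`,
`S_δ = S ∩ δ⁻¹ S δ` has finite index in `S`. -/
theorem finiteIndex_heckeSubgroup (h𝔪 : IsLattice K 𝔪) {S : Subgroup (GL (Fin 3) K)}
    (hS : S ≤ shimuraLevelSubgroup K H 𝔪 1) {N' : ℕ} (hN' : N' ≠ 0)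
    (hS' : shimuraLevelSubgroup K H 𝔪 N' ≤ S) {δ : GL (Fin 3) K} (hδ : δ ∈ unitaryGroup K H) :
    ((heckeSubgroup S δ).subgroupOf S).FiniteIndex := by
  obtain ⟨M, hM, hconj⟩ := exists_conj_shimuraLevel_subset h𝔪 hδ N' hN'
  -- `S ⊓ Γ_M ≤ S_δ`
  have hle : S ⊓ shimuraLevelSubgroup K H 𝔪 M ≤ heckeSubgroup S δ := by
    intro γ hγ
    refine (mem_heckeSubgroup S δ).mpr ⟨hγ.1, hS' ?_⟩
    have hγM : γ ∈ shimuraLevel K H 𝔪 M := by rw [← coe_shimuraLevelSubgroup]; exact hγ.2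
    rw [← SetLike.mem_coe, coe_shimuraLevelSubgroup]
    exact hconj γ hγM
  -- `[S : S ⊓ Γ_M] < ∞` from `[Γ₁ : Γ_M] < ∞` and `S ≤ Γ₁`
  haveI := finiteIndex_subgroupOf_shimuraLevel H 𝔪 h𝔪 hM
  have h1 : (shimuraLevelSubgroup K H 𝔪 M).relIndex (shimuraLevelSubgroup K H 𝔪 1) ≠ 0 :=
    Subgroup.FiniteIndex.index_ne_zero
  have h2 : (shimuraLevelSubgroup K H 𝔪 M).relIndex S ≠ 0 :=
    fun h => h1 (Subgroup.relIndex_eq_zero_of_le_right hS h)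
  have h3 : (S ⊓ shimuraLevelSubgroup K H 𝔪 M).relIndex S ≠ 0 := by
    unfold Subgroup.relIndex
    rw [Subgroup.inf_subgroupOf_left]
    exact h2
  have h4 : (heckeSubgroup S δ).relIndex S ≠ 0 :=
    fun h => h3 (Subgroup.relIndex_eq_zero_of_le_left hle h)
  exact Subgroup.finiteIndex_iff.mpr h4

/-- The `Fintype` instance on `S ⧸ S_δ` needed by the Hecke operators, for congruence subgroups. -/
@[reducible] noncomputable def fintypeHeckeQuotient (h𝔪 : IsLattice K 𝔪) {S : Subgroup (GL (Fin 3) K)}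
    (hS : S ≤ shimuraLevelSubgroup K H 𝔪 1) {N' : ℕ} (hN' : N' ≠ 0)
    (hS' : shimuraLevelSubgroup K H 𝔪 N' ≤ S) {δ : GL (Fin 3) K} (hδ : δ ∈ unitaryGroup K H) :
    Fintype (S ⧸ (heckeSubgroup S δ).subgroupOf S) :=
  haveI := finiteIndex_heckeSubgroup h𝔪 hS hN' hS' hδ
  Fintype.ofFinite _

end FiniteIndex

end Summit.Ventures.HodgeRepro2.ShimuraData
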